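import Summits.CriticalPhenomena.PercolationContinuityZ3.Theorems.PercNearOneGluingNoHeavyLowerTailMajorityGluingQCertSymCount
import Summits.CriticalPhenomena.PercolationContinuityZ3.Theorems.PercNearOneGluingNoHeavyLowerTailMajorityGluingQCert3SliceSound
import HarnessLib

/-!
# Symmetrised certificates checked IN PARTS: digests of partial contribution lists (lane prim-rate, constants-miner 1, gen 36; CANDIDATES §GEN-36, NEXT-g37)

Support file for the closed crux `NoHeavyLowerTail` (stmt-CriticalPhenomena-4575), majority-gluing line; companion of `…MajorityGluingQCertSym*`.
The kernel cost of `SymCert.checkQS` is the computation of one orbit key per contribution; for the cells `m ≥ 10` a certificate has more contributions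
than one `decide +kernel` should evaluate.  Here a certificate is split into PARTS sharing the cell parameters (`SymCert.concat`); each part is digested
separately — `SymCert.digest c fuel = aggr (msort2 fuel c.contribsS)`, the key-sorted contribution list with equal keys summed (`aggr`, a structural scan),
a SHORT list stated as data and verified by its own `decide +kernel` — and the digests are glued: if `runsOK (msort2 fuel (digests.flatten))` then the
concatenated certificate's contribution list evaluates nonnegatively at every nonnegative key valuation (`SymCert.pos_of_digests`, via `evalC_aggr`,
`evalC_digest`, `evalC_concat`), which is what the evaluation form `SymCert.cut_of_posS_count` of the counting theorem consumes
(`SymCert.cut_of_digests_count`).  No sorries.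
-/

namespace Summit.CriticalPhenomena.PercolationContinuityZ3.Theorems

namespace HubOnly
namespace QCert

/-! ### Aggregating runs of equal keys -/

/-- Scan with current key `k` and accumulated coefficient `acc`, emitting one entry per completed run. -/
def aggrGo (k : ℕ) (acc : ℤ) : List (ℕ × ℤ) → List (ℕ × ℤ)
  | [] => [(k, acc)]
  | e :: l => if e.1 = k then aggrGo k (acc + e.2) l else (k, acc) :: aggrGo e.1 e.2 l

/-- **Run aggregation:** adjacent entries with equal keys are summed (applied to a key-sorted list this is the list of key totals). -/
def aggr : List (ℕ × ℤ) → List (ℕ × ℤ)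
  | [] => []
  | e :: l => aggrGo e.1 e.2 l

section Eval

/-- The scan preserves the value: `evalC (aggrGo k acc l) = acc·val k + evalC l`. -/
theorem evalC_aggrGo (val : ℕ → ℝ) : ∀ (k : ℕ) (acc : ℤ) (l : List (ℕ × ℤ)), evalC val (aggrGo k acc l) = (acc : ℝ) * val k + evalC val l
  | k, acc, [] => by simp [aggrGo, evalC]
  | k, acc, e :: l => by
    unfold aggrGo
    split_ifs with h
    · rw [evalC_aggrGo val k (acc + e.2) l, evalC_cons, h]; push_cast; ring
    · rw [evalC_cons, evalC_aggrGo val e.1 e.2 l, evalC_cons]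

/-- **Aggregation preserves the value** at every valuation. -/
theorem evalC_aggr (val : ℕ → ℝ) : ∀ l : List (ℕ × ℤ), evalC val (aggr l) = evalC val l
  | [] => rfl
  | e :: l => by unfold aggr; rw [evalC_aggrGo, evalC_cons]

end Eval

/-! ### Digests and gluing of parts -/

namespace SymCert

/-- **The digest of a (partial) certificate:** its key-sorted contribution list with equal keys summed. -/
def digest (c : SymCert) (fuel : ℕ) : List (ℕ × ℤ) := aggr (msort2 fuel c.contribsS)

/-- The digest evaluates like the contribution list. -/
theorem evalC_digest (c : SymCert) (fuel : ℕ) (val : ℕ → ℝ) : evalC val (c.digest fuel) = evalC val c.contribsS := by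
  unfold digest; rw [evalC_aggr, evalC_perm val (msort2_perm fuel _)]

/-- Gluing two parts with the same cell parameters: concatenated entry lists on the base of the first. -/
def append (c d : SymCert) : SymCert := ⟨c.base, c.ell ++ d.ell, c.lin ++ d.lin, c.rows ++ d.rows, c.sqs ++ d.sqs⟩

/-- **Gluing a list of parts** on a common base. -/
def concat (b : Cert) : List SymCert → SymCert
  | [] => ⟨b, [], [], [], []⟩
  | d :: l => d.append (concat b l)

/-- The base of a concatenation. -/
theorem concat_base (b : Cert) : ∀ l : List SymCert, (∀ d ∈ l, d.base = b) → (concat b l).base = b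
  | [], _ => rfl
  | d :: l, h => by unfold concat append; exact h d (by simp)

/-- Two certificates with the same base have the same entry-contribution maps. -/
theorem contribsS_eq_of_base (c : SymCert) (b : Cert) (hb : c.base = b) (ell : List (ℕ × ℕ)) (lin : List (ℕ × ℕ × ℕ))
    (rows : List (List RowE)) (sqs : List (List SqE)) :
    (⟨b, ell, lin, rows, sqs⟩ : SymCert).contribsS =
      (ell.map c.ellC).flatten ++ (lin.map c.linC1).flatten ++ (rows.map fun ch => (ch.map c.rowCS).flatten).flatten ++
        (sqs.map fun ch => (ch.map c.sqCS).flatten).flatten := by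
  subst hb; rfl

/-- **Gluing two parts adds their values** (same base). -/
theorem evalC_appendS (c d : SymCert) (h : d.base = c.base) (val : ℕ → ℝ) :
    evalC val (c.append d).contribsS = evalC val c.contribsS + evalC val d.contribsS := by
  cases d with
  | mk base ell lin rows sqs =>
    simp only at h
    subst h
    unfold append
    rw [contribsS_eq_of_base c c.base rfl (c.ell ++ ell), contribsS_eq_of_base c c.base rfl ell]
    unfold contribsS
    simp only [List.map_append, List.flatten_append, QCert.evalC_append]
    ring

/-- **The glued certificate evaluates to the sum of its parts** (common base). -/
theorem evalC_concat (b : Cert) (val : ℕ → ℝ) :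
    ∀ l : List SymCert, (∀ d ∈ l, d.base = b) → evalC val (concat b l).contribsS = (l.map fun d => evalC val d.contribsS).sum
  | [], _ => by simp [concat, contribsS, evalC]
  | d :: l, h => by
    have hd : d.base = b := h d (by simp)
    have hl : ∀ d' ∈ l, d'.base = b := fun d' hd' => h d' (List.mem_cons_of_mem _ hd')
    have hcb := concat_base b l hl
    rw [List.map_cons, List.sum_cons, ← evalC_concat b val l hl, show concat b (d :: l) = d.append (concat b l) from rfl,
      evalC_appendS d (concat b l) (by rw [hcb, hd]) val]

/-- The parts' values are the digests' values. -/
theorem map_evalC_of_digests (fuel : ℕ) (val : ℕ → ℝ) {l : List SymCert} {D : List (List (ℕ × ℤ))}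
    (hD : List.Forall₂ (fun d dg => d.digest fuel = dg) l D) : (l.map fun d => evalC val d.contribsS) = D.map (evalC val) := by
  induction hD with
  | nil => rfl
  | cons hdg _ ih => rw [List.map_cons, List.map_cons, ih, ← hdg, evalC_digest]

/-- **NONNEGATIVITY FROM DIGESTS:** if every part's digest is the stated list and the run check accepts the key-sorted concatenation of the stated
lists, the glued certificate's contribution list evaluates nonnegatively at every nonnegative key valuation. -/
theorem pos_of_digests (b : Cert) (l : List SymCert) (hb : ∀ d ∈ l, d.base = b) (fuel : ℕ) (D : List (List (ℕ × ℤ)))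
    (hD : List.Forall₂ (fun d dg => d.digest fuel = dg) l D) (hruns : runsOK (msort2 fuel D.flatten) = true)
    (val : ℕ → ℝ) (hval : ∀ key, 0 ≤ val key) : 0 ≤ evalC val (concat b l).contribsS := by
  rw [evalC_concat b val l hb, map_evalC_of_digests fuel val hD, ← evalC_flatten]
  exact evalC_nonneg_of_runsOK_msort2 val hval fuel _ hruns

section Count

open scoped Classical

/-- **«AT LEAST `h` OF `k` RELAYS CUT» FROM A CERTIFICATE CHECKED IN PARTS** (counting form): structure check of the glued certificate, the parts'
digests, and the run check of the glued digests give `cD·μ(h ≤ #{v ∈ T : v ↮ a₀}) ≤ cN·δ`. [cite: VandenbergKahn2001, Thm 1.2 (p. 123)] -/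
theorem cut_of_digests_count {n k : ℕ} (b : Cert) (l : List SymCert) (hb : ∀ d ∈ l, d.base = b) (hm : (concat b l).base.m = k)
    (hWS : (concat b l).checkWS = true) (fuel : ℕ) (D : List (List (ℕ × ℤ))) (hD : List.Forall₂ (fun d dg => d.digest fuel = dg) l D)
    (hruns : runsOK (msort2 fuel D.flatten) = true)
    (w : Sym2 (Fin n) → unitInterval) (a₀ : Fin n) (T : Finset (Fin n)) (hT : T.card = k) (δ : ℝ) (hδ0 : 0 ≤ δ)
    (hδ : ∀ v ∈ T, (Literature.Probability.LatticeModels.prodBernoulli w).real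
      (Literature.Probability.Percolation.openConn v a₀ : Set (Literature.Probability.Percolation.BondConfig (Fin n)))ᶜ ≤ δ) :
    ((concat b l).base.cD : ℝ) * (Literature.Probability.LatticeModels.prodBernoulli w).real
        {ω : Literature.Probability.Percolation.BondConfig (Fin n) |
          (concat b l).base.h ≤ (T.filter fun v => ω ∉ Literature.Probability.Percolation.openConn v a₀).card} ≤ (concat b l).base.cN * δ :=
  (concat b l).cut_of_posS_count hm hWS (pos_of_digests b l hb fuel D hD hruns) w a₀ T hT δ hδ0 hδ

end Count

end SymCert

/-! ### Smoke test: the `(2,1)` certificate split into two parts -/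

/-- First part of the smoke certificate: the multiplier and one marginal slack. -/
def symSmokeP1 : SymCert := ⟨⟨2, 1, 2, 1, 1, [], [], []⟩, [(4, 1)], [(0, 4, 1)], [], []⟩

/-- Second part: the other marginal slack. -/
def symSmokeP2 : SymCert := ⟨⟨2, 1, 2, 1, 1, [], [], []⟩, [], [(1, 4, 1)], [], []⟩

/-- Digest of part 1 (keys `j + 5·i` of the canonical pairs `(i, j) = (D, 1), (D, 3), (D, D)`, `D = 4`, `N = 5`). -/
theorem symSmokeP1_digest : symSmokeP1.digest 8 = [(21, -1), (23, 0), (24, 1)] := by decide +kernel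

/-- Digest of part 2. -/
theorem symSmokeP2_digest : symSmokeP2.digest 8 = [(21, 1), (23, 1), (24, -1)] := by decide +kernel

/-- The glued digests pass the run check, and the glued certificate is structurally sound. -/
theorem symSmoke_parts_ok : runsOK (msort2 8 [[((21 : ℕ), (-1 : ℤ)), (23, 0), (24, 1)], [(21, 1), (23, 1), (24, -1)]].flatten) = true ∧
    (SymCert.concat ⟨2, 1, 2, 1, 1, [], [], []⟩ [symSmokeP1, symSmokeP2]).checkWS = true := by
  constructor <;> decide +kernel

end QCert
end HubOnly

end Summit.CriticalPhenomena.PercolationContinuityZ3.Theorems
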